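import Literature.Geometry.MetricGeometry.PointedGHPrecompactness
import Literature.Geometry.MetricGeometry.UltralimitGroup
import Literature.Geometry.MetricGeometry.Submetry
import HarnessLib

/-!
# Equivariant pointed Gromov–Hausdorff convergence to the ultralimit (Fukaya–Yamaguchi, pointed form)

Huang–Huang–Wang–Zhu 2026, Thm 2.1 (arXiv:2605.24380, §2.1 p. 6; Fukaya 1986, Fukaya–Yamaguchi
1992, Prop. 3.6): "Let `(Xᵢ, pᵢ)` … converge to `(X, p)` in the pointed Gromov–Hausdorff sense. For
each `i`, let `Gᵢ` be a closed subgroup of `Isom(Xᵢ)`. Then passing to a subsequence if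
necessary, `(Xᵢ, pᵢ, Gᵢ) → (X, p, G)`, where `G` is a closed subgroup of `Isom(X)`." The tree has the
vocabulary (`IsPointedEquivGHApprox`, `PointedEquivGHConv`, `PointedGromovHausdorff.lean` §6), the
compact case (`EquivariantGHLimit.lean`), the pointed limit space (`Ultralimit.lean`,
`PointedGHPrecompactness.lean`) and the limit group `limitGroup Γ p U ≤ Isom(lim_U Xᵢ)` of
bounded-displacement sequences of isometries (`UltralimitGroup.lean`). This file proves the
POINTED theorem with that limit group (the printed `G` is its closure, which does not change
equivariant convergence):

* `eventually_exists_isPointedEquivGHApprox` — **for every `r ≥ 0`, `ε > 0`, `U`-almost every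
  `(Xᵢ, pᵢ, Γᵢ)` admits a pointed `(r, ε)`-EQUIVARIANT approximation to
  `(lim_U Xᵢ, basePt, limitGroup)`**. Proof: with the transported-net approximation `f` of
  `PointedGHPrecompactness.lean`, record the *behaviour* of an isometry on the net — the finite
  matrix `d(γ eᵢ(a), eᵢ(b))` — a point of a cube in `ℝ^{(N+1)²}`; the behaviour of a limit isometry
  is the `U`-limit of the behaviours of its representatives (`eventually_dist_beh_lt`); an
  ultrafilter dichotomy shows that `U`-almost everywhere every `γ ∈ Γᵢ(r)` behaves within `ε₀` of
  some limit isometry (`φᵢ`), and the total boundedness of the cube that the behaviours of `G(r)` are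
  realised within `ε₀` by elements of `Γᵢ` (`ψᵢ`); behaviour-closeness controls
  `d(φ(γ) f x, f(γ x))` and `d(k f x, f(ψ(k) x))` through the net;
* `exists_strictMono_pointedEquivGHConv` — **the theorem**: under uniformly bounded covering
  numbers, a subsequence `(X_{φ n}, p_{φ n}, Γ_{φ n})` converges to
  `(lim_U Xᵢ, basePt, limitGroup)` in the sense of `PointedEquivGHConv`.

Everything is proved; no definitions besides proof-local abbreviations, no named facts.

## References

* K. Fukaya, T. Yamaguchi, *The fundamental groups of almost nonnegatively curved manifolds*,
  Ann. of Math. 136 (1992) 253–333, §3, Prop. 3.6. (Context.)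
* H. Huang, X.-T. Huang, J. Wang, X. Zhu, arXiv:2605.24380 (2026), §2.1 p. 6, Thm 2.1.
  [HuangHuangWangZhu2026]
-/

noncomputable section

open Set Filter Metric Topology

namespace Literature.Geometry.MetricGeometry

namespace Ultralimit

variable {X : ℕ → Type*} [∀ i, PseudoMetricSpace (X i)]
  {Γ : ℕ → Type*} [∀ i, Group (Γ i)] [∀ i, MulAction (Γ i) (X i)] [∀ i, IsIsometricSMul (Γ i) (X i)]
  {p : ∀ i, X i} {U : Ultrafilter ℕ}

/-! ### §1. Representatives of limit isometries -/

/-- Admissible sequences agreeing `U`-almost everywhere induce the same limit isometry.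
[cite: HuangHuangWangZhu2026, §2.1 p. 6 Thm 2.1] -/
theorem limitHom_eq_of_eventuallyEq {g g' : admissibleSubgroup Γ p}
    (h : ∀ᶠ j in (U : Filter ℕ), (g : ∀ i, Γ i) j = (g' : ∀ i, Γ i) j) :
    limitHom Γ p U g = limitHom Γ p U g' := by
  ext y
  obtain ⟨x, rfl⟩ := mk_surjective y
  rw [limitHom_apply, limitHom_apply, smul_mk, smul_mk]
  show SeparationQuotient.mk _ = SeparationQuotient.mk _
  refine SeparationQuotient.mk_eq_mk.2 (Metric.inseparable_iff.2 (le_antisymm ?_ dist_nonneg))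
  refine PreUltralimit.dist_le_of_eventually_le (h.mono fun j hj ↦ ?_)
  simp [hj]

/-- The distance of transported points converges: for admissible `g`, `x`, `y`,
`|d(gⱼ xⱼ, yⱼ) - d(g • [x], [y])| < ε` for `U`-almost all `j`. [cite: HuangHuangWangZhu2026, §2.1 p. 6 Thm 2.1] -/
theorem eventually_abs_dist_smul_sub_lt (g : admissibleSubgroup Γ p) (x y : PreUltralimit p U)
    {ε : ℝ} (hε : 0 < ε) :
    ∀ᶠ j in (U : Filter ℕ),
      |dist ((g : ∀ i, Γ i) j • x.seq j) (y.seq j) - dist (g • (mk x : Ultralimit p U)) (mk y)| < ε := by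
  have := (g • x).eventually_abs_dist_sub_lt y hε
  refine this.mono fun j hj ↦ ?_
  rwa [smul_mk, dist_mk]

/-- **Representatives with controlled displacement**: a limit isometry moving the base point by
`< r'` is induced by an admissible sequence all of whose terms move the base points by `≤ r'`
(replace the terms with larger displacement — a `U`-null set of indices — by the identity).
[cite: HuangHuangWangZhu2026, §2.1 p. 6 Thm 2.1] -/
theorem exists_rep_of_dist_basePt_lt {k : Ultralimit p U ≃ᵢ Ultralimit p U}
    (hk : k ∈ limitGroup Γ p U) {r' : ℝ} (h : dist (k (basePt p U)) (basePt p U) < r') :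
    ∃ g : admissibleSubgroup Γ p, (∀ j, dist ((g : ∀ i, Γ i) j • p j) (p j) ≤ r') ∧
      limitHom Γ p U g = k := by
  classical
  obtain ⟨g₀, rfl⟩ := mem_limitGroup_iff.1 hk
  have hr' : 0 ≤ r' := dist_nonneg.trans h.le
  have hev : ∀ᶠ j in (U : Filter ℕ), dist ((g₀ : ∀ i, Γ i) j • p j) (p j) < r' := by
    rw [limitHom_apply, basePt, smul_mk, dist_mk] at h
    simpa using PreUltralimit.eventually_dist_lt h
  set g : ∀ i, Γ i := fun j ↦ if dist ((g₀ : ∀ i, Γ i) j • p j) (p j) ≤ r' then (g₀ : ∀ i, Γ i) j else 1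
    with hg
  have hgd : ∀ j, dist (g j • p j) (p j) ≤ r' := fun j ↦ by
    simp only [hg]
    split_ifs with hj
    · exact hj
    · simpa using hr'
  have hadm : g ∈ admissibleSubgroup Γ p := ⟨r', hgd⟩
  refine ⟨⟨g, hadm⟩, hgd, limitHom_eq_of_eventuallyEq (hev.mono fun j hj ↦ ?_)⟩
  show g j = _
  simp only [hg, if_pos hj.le]

/-! ### §2. The equivariant approximations -/

/-- **`U`-almost every `(Xᵢ, pᵢ, Γᵢ)` is equivariantly close to the ultralimit with its limit
group** (the core of Fukaya–Yamaguchi's Prop. 3.6 in pointed form, for the ultralimit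
realisation): if the balls `B̄(pᵢ, R)` admit `ε`-dense subsets of cardinality bounded
independently of `i` (all `R`, `ε > 0`), then for all `r ≥ 0`, `ε > 0`, for `U`-almost every `i`
there is a pointed `(r, ε)`-equivariant Gromov–Hausdorff approximation
`(Xᵢ, pᵢ, Γᵢ) → (lim_U Xⱼ, basePt, limitGroup)`. [cite: HuangHuangWangZhu2026, §2.1 p. 6 Thm 2.1] -/
theorem eventually_exists_isPointedEquivGHApprox
    (hcov : ∀ (R ε : ℝ), 0 < ε → ∃ N : ℕ, ∀ i, ∃ S : Finset (X i), S.card ≤ N ∧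
      ∀ x ∈ closedBall (p i) R, ∃ s ∈ S, dist x s ≤ ε)
    {r : ℝ} (hr : 0 ≤ r) {ε : ℝ} (hε : 0 < ε) :
    ∀ᶠ i in (U : Filter ℕ), ∃ (f : X i → Ultralimit p U) (φ : Γ i → limitGroup Γ p U)
      (ψ : limitGroup Γ p U → Γ i),
      IsPointedEquivGHApprox r ε (p i) (basePt p U) f φ ψ := by
  classical
  -- scales
  set ε₀ : ℝ := ε / 10 with hε₀
  have hε₀0 : 0 < ε₀ := by positivity
  set R : ℝ := 2 * r + ε + 1 with hR
  have hR0 : 0 ≤ R := by positivity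
  have hrR : r ≤ R := by linarith
  -- nets inside the balls of radius `R`
  obtain ⟨N, hN⟩ := hcov R ε₀ hε₀0
  choose S hScard hScov using hN
  choose e he0 heR hecov using fun i ↦ exists_net_fun hR0 (hScard i) (hScov i)
  set net : ℕ → PreUltralimit p U := fun k ↦ ⟨fun i ↦ e i k, R, fun i ↦ heR i k⟩ with hnet
  set c : ℕ → Ultralimit p U := fun k ↦ Ultralimit.mk (net k) with hc
  have hc0 : c 0 = basePt p U := by
    refine eq_of_dist_eq_zero ?_
    simp only [hc, dist_mk_basePt, hnet, he0, dist_self]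
    exact ulimReal_const 0
  have hcdist : ∀ k l, dist (c k) (c l) = dist (net k) (net l) := fun k l ↦ dist_mk _ _
  -- behaviours of isometries on the net: points of `Fin (N+1) × Fin (N+1) → ℝ`
  set beh : ∀ i, Γ i → (Fin (N + 1) × Fin (N + 1) → ℝ) :=
    fun i γ ab ↦ dist (γ • e i ab.1) (e i ab.2) with hbeh
  set behL : (Ultralimit p U ≃ᵢ Ultralimit p U) → (Fin (N + 1) × Fin (N + 1) → ℝ) :=
    fun k ab ↦ dist (k (c ab.1)) (c ab.2) with hbehL
  -- (L2) the behaviour of a limit isometry is the limit of the behaviours of a representative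
  have hL2 : ∀ g : admissibleSubgroup Γ p, ∀ᶠ j in (U : Filter ℕ),
      dist (beh j ((g : ∀ i, Γ i) j)) (behL (limitHom Γ p U g)) < ε₀ := by
    intro g
    have h1 : ∀ ab : Fin (N + 1) × Fin (N + 1), ∀ᶠ j in (U : Filter ℕ),
        dist (beh j ((g : ∀ i, Γ i) j) ab) (behL (limitHom Γ p U g) ab) < ε₀ := fun ab ↦ by
      refine (eventually_abs_dist_smul_sub_lt g (net ab.1) (net ab.2) hε₀0).mono fun j hj ↦ ?_
      rwa [Real.dist_eq]
    exact (eventually_all.2 h1).mono fun j hj ↦ (dist_pi_lt_iff hε₀0).2 hj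
  -- (L3) dichotomy: `U`-a.e. every `γ ∈ Γᵢ(r)` behaves like some limit isometry of displacement `≤ r`
  have hL3 : ∀ᶠ i in (U : Filter ℕ), ∀ γ : Γ i, dist (γ • p i) (p i) ≤ r →
      ∃ g : admissibleSubgroup Γ p, (∀ j, dist ((g : ∀ i, Γ i) j • p j) (p j) ≤ r) ∧
        dist (beh i γ) (behL (limitHom Γ p U g)) < ε₀ := by
    by_contra hcon
    rw [← Ultrafilter.eventually_not] at hcon
    -- choose a bad `γᵢ` on the `U`-large bad set, the identity elsewhere
    have hbad : ∀ i, ∃ γ : Γ i, (¬ (∀ γ' : Γ i, dist (γ' • p i) (p i) ≤ r →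
        ∃ g : admissibleSubgroup Γ p, (∀ j, dist ((g : ∀ i, Γ i) j • p j) (p j) ≤ r) ∧
          dist (beh i γ') (behL (limitHom Γ p U g)) < ε₀)) →
        (dist (γ • p i) (p i) ≤ r ∧ ∀ g : admissibleSubgroup Γ p,
          (∀ j, dist ((g : ∀ i, Γ i) j • p j) (p j) ≤ r) →
            ε₀ ≤ dist (beh i γ) (behL (limitHom Γ p U g))) := by
      intro i
      by_cases h : ∀ γ' : Γ i, dist (γ' • p i) (p i) ≤ r →
          ∃ g : admissibleSubgroup Γ p, (∀ j, dist ((g : ∀ i, Γ i) j • p j) (p j) ≤ r) ∧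
            dist (beh i γ') (behL (limitHom Γ p U g)) < ε₀
      · exact ⟨1, fun hn ↦ (hn h).elim⟩
      · push Not at h
        obtain ⟨γ, hγr, hγ⟩ := h
        exact ⟨γ, fun _ ↦ ⟨hγr, fun g hg ↦ hγ g hg⟩⟩
    choose γ hγ using hbad
    set g : ∀ i, Γ i := fun i ↦
      if h : ∀ γ' : Γ i, dist (γ' • p i) (p i) ≤ r →
          ∃ g : admissibleSubgroup Γ p, (∀ j, dist ((g : ∀ i, Γ i) j • p j) (p j) ≤ r) ∧
            dist (beh i γ') (behL (limitHom Γ p U g)) < ε₀ then 1 else γ i with hg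
    have hgd : ∀ i, dist (g i • p i) (p i) ≤ r := fun i ↦ by
      simp only [hg]
      split_ifs with h
      · simpa using hr
      · exact (hγ i h).1
    have hadm : g ∈ admissibleSubgroup Γ p := ⟨r, hgd⟩
    have h2 := hL2 ⟨g, hadm⟩
    obtain ⟨i, hi, hnot⟩ := (h2.and hcon).exists
    have hgi : g i = γ i := by simp only [hg, dif_neg hnot]
    have := (hγ i hnot).2 ⟨g, hadm⟩ hgd
    rw [← hgi] at this
    exact absurd hi (not_lt.2 this)
  -- (L1)+(L4): finitely many limit behaviours of `G(r)` suffice, each realised `U`-a.e.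
  set BL : Set (Fin (N + 1) × Fin (N + 1) → ℝ) :=
    behL '' {k | k ∈ limitGroup Γ p U ∧ dist (k (basePt p U)) (basePt p U) ≤ r} with hBL
  have hBLbdd : BL ⊆ closedBall (fun _ ↦ (0 : ℝ)) (2 * R + r) := by
    rintro _ ⟨k, ⟨-, hk⟩, rfl⟩
    rw [mem_closedBall, dist_pi_le_iff (by positivity)]
    intro ab
    simp only [hbehL, Real.dist_eq, sub_zero, abs_of_nonneg dist_nonneg]
    have h1 : dist (c ab.1) (basePt p U) ≤ R := by
      rw [hc, dist_mk_basePt]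
      exact ulimReal_le_of_eventually_le (C := R) (fun i ↦ by
        rw [abs_of_nonneg dist_nonneg]; exact heR i _) (Eventually.of_forall fun i ↦ heR i _)
    have h2 : dist (c ab.2) (basePt p U) ≤ R := by
      rw [hc, dist_mk_basePt]
      exact ulimReal_le_of_eventually_le (C := R) (fun i ↦ by
        rw [abs_of_nonneg dist_nonneg]; exact heR i _) (Eventually.of_forall fun i ↦ heR i _)
    calc dist (k (c ab.1)) (c ab.2)
        ≤ dist (k (c ab.1)) (k (basePt p U)) + dist (k (basePt p U)) (basePt p U) +
            dist (basePt p U) (c ab.2) := dist_triangle4 _ _ _ _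
      _ = dist (c ab.1) (basePt p U) + dist (k (basePt p U)) (basePt p U) +
            dist (basePt p U) (c ab.2) := by rw [k.dist_eq]
      _ ≤ R + r + R := by rw [dist_comm (basePt p U)]; linarith
      _ = 2 * R + r := by ring
  have hBLtb : TotallyBounded BL :=
    (isCompact_closedBall _ _).totallyBounded.subset hBLbdd
  obtain ⟨T, hTBL, hTfin, hTcov⟩ := finite_approx_of_totallyBounded hBLtb ε₀ hε₀0
  -- representatives for the finitely many behaviours
  have hrep : ∀ t ∈ T, ∃ g : admissibleSubgroup Γ p,
      (∀ j, dist ((g : ∀ i, Γ i) j • p j) (p j) ≤ r + ε₀) ∧ behL (limitHom Γ p U g) = t := by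
    intro t ht
    obtain ⟨k, ⟨hkG, hkr⟩, rfl⟩ := hTBL ht
    obtain ⟨g, hg, hgk⟩ := exists_rep_of_dist_basePt_lt hkG (r' := r + ε₀) (by linarith)
    exact ⟨g, hg, by rw [hgk]⟩
  choose! grep hgrep_disp hgrep_beh using hrep
  have hL4 : ∀ᶠ i in (U : Filter ℕ), ∀ t ∈ hTfin.toFinset,
      dist (beh i ((grep t : ∀ i, Γ i) i)) t < ε₀ := by
    rw [Filter.eventually_all_finset]
    intro t ht
    have ht' : t ∈ T := hTfin.mem_toFinset.1 ht
    have := hL2 (grep t)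
    rw [hgrep_beh t ht'] at this
    exact this
  -- good indices for the net distances
  have hgood : ∀ᶠ i in (U : Filter ℕ), ∀ k ∈ Finset.range (N + 1), ∀ l ∈ Finset.range (N + 1),
      |dist (e i k) (e i l) - dist (c k) (c l)| < ε₀ := by
    rw [Filter.eventually_all_finset]
    intro k _
    rw [Filter.eventually_all_finset]
    intro l _
    refine ((net k).eventually_abs_dist_sub_lt (net l) hε₀0).mono fun i hi ↦ ?_
    rw [hcdist]
    exact hi
  -- the main construction at a good index
  filter_upwards [hgood, hL3, hL4] with i hi h3 h4
  have hi' : ∀ k, k ≤ N → ∀ l, l ≤ N → |dist (e i k) (e i l) - dist (c k) (c l)| < ε₀ :=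
    fun k hk l hl ↦ hi k (Finset.mem_range.2 (Nat.lt_succ_iff.2 hk)) l
      (Finset.mem_range.2 (Nat.lt_succ_iff.2 hl))
  -- the index of a net point near `x`, and the approximation `f`
  set kf : X i → ℕ := fun x ↦
    if x = p i then 0 else
      if h : ∃ k, k ≤ N ∧ dist x (e i k) ≤ 2 * ε₀ then h.choose else 0 with hkf
  have hkfP : ∀ x ∈ closedBall (p i) R, kf x ≤ N ∧ dist x (e i (kf x)) ≤ 2 * ε₀ := by
    intro x hx
    simp only [hkf]
    split_ifs with hxp h
    · subst hxp
      rw [he0, dist_self]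
      exact ⟨Nat.zero_le _, by positivity⟩
    · exact h.choose_spec
    · exact (h (hecov i x hx)).elim
  have hkf0 : kf (p i) = 0 := by simp [hkf]
  set f : X i → Ultralimit p U := fun x ↦ c (kf x) with hf
  -- the behaviour estimate: closeness of behaviours controls `d(k f x, f (γ x))`
  have key : ∀ (γ : Γ i) (k : Ultralimit p U ≃ᵢ Ultralimit p U) (η : ℝ),
      dist (beh i γ) (behL k) < η → dist (γ • p i) (p i) ≤ r + ε₀ →
      ∀ x ∈ closedBall (p i) r, dist (k (f x)) (f (γ • x)) ≤ 4 * ε₀ + η := by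
    intro γ k η hclose hγ x hx
    have hxR : x ∈ closedBall (p i) R := closedBall_subset_closedBall hrR hx
    have hγxR : γ • x ∈ closedBall (p i) R := by
      rw [mem_closedBall]
      calc dist (γ • x) (p i) ≤ dist (γ • x) (γ • p i) + dist (γ • p i) (p i) := dist_triangle _ _ _
        _ = dist x (p i) + dist (γ • p i) (p i) := by rw [dist_smul]
        _ ≤ r + (r + ε₀) := add_le_add (mem_closedBall.1 hx) hγ
        _ ≤ R := by rw [hR, hε₀]; linarith
    obtain ⟨ha, hda⟩ := hkfP x hxR
    obtain ⟨hb, hdb⟩ := hkfP (γ • x) hγxR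
    set a : Fin (N + 1) := ⟨kf x, Nat.lt_succ_of_le ha⟩ with ha_def
    set b : Fin (N + 1) := ⟨kf (γ • x), Nat.lt_succ_of_le hb⟩ with hb_def
    have hentry := dist_le_pi_dist (beh i γ) (behL k) (a, b)
    have hL : behL k (a, b) = dist (k (f x)) (f (γ • x)) := rfl
    have hB : beh i γ (a, b) = dist (γ • e i (kf x)) (e i (kf (γ • x))) := rfl
    have h1 : dist (γ • e i (kf x)) (e i (kf (γ • x))) ≤ 4 * ε₀ :=
      calc dist (γ • e i (kf x)) (e i (kf (γ • x)))
          ≤ dist (γ • e i (kf x)) (γ • x) + dist (γ • x) (e i (kf (γ • x))) := dist_triangle _ _ _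
        _ = dist (e i (kf x)) x + dist (γ • x) (e i (kf (γ • x))) := by rw [dist_smul]
        _ ≤ 2 * ε₀ + 2 * ε₀ := add_le_add (by rw [dist_comm]; exact hda) hdb
        _ = 4 * ε₀ := by ring
    rw [hL, hB, Real.dist_eq] at hentry
    have := (abs_lt.1 (hentry.trans_lt hclose)).1
    linarith
  -- the maps `φ` and `ψ`
  have hφex : ∀ γ : Γ i, ∃ G' : limitGroup Γ p U, dist (γ • p i) (p i) ≤ r →
      dist (beh i γ) (behL (G' : Ultralimit p U ≃ᵢ Ultralimit p U)) < ε₀ := by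
    intro γ
    by_cases hγ : dist (γ • p i) (p i) ≤ r
    · obtain ⟨g, -, hg⟩ := h3 γ hγ
      exact ⟨⟨limitHom Γ p U g, mem_limitGroup_iff.2 ⟨g, rfl⟩⟩, fun _ ↦ hg⟩
    · exact ⟨1, fun h ↦ (hγ h).elim⟩
  choose φ hφ using hφex
  have hψex : ∀ k : limitGroup Γ p U, ∃ γ : Γ i,
      dist ((k : Ultralimit p U ≃ᵢ Ultralimit p U) (basePt p U)) (basePt p U) ≤ r →
        dist (γ • p i) (p i) ≤ r + ε₀ ∧
          dist (beh i γ) (behL (k : Ultralimit p U ≃ᵢ Ultralimit p U)) < 2 * ε₀ := by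
    intro k
    by_cases hk : dist ((k : Ultralimit p U ≃ᵢ Ultralimit p U) (basePt p U)) (basePt p U) ≤ r
    · have hmem : behL (k : Ultralimit p U ≃ᵢ Ultralimit p U) ∈ BL := ⟨k, ⟨k.2, hk⟩, rfl⟩
      obtain ⟨t, ht, hkt⟩ := mem_iUnion₂.1 (hTcov hmem)
      rw [mem_ball] at hkt
      refine ⟨(grep t : ∀ i, Γ i) i, fun _ ↦ ⟨hgrep_disp t ht i, ?_⟩⟩
      calc dist (beh i ((grep t : ∀ i, Γ i) i)) (behL (k : Ultralimit p U ≃ᵢ Ultralimit p U))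
          ≤ dist (beh i ((grep t : ∀ i, Γ i) i)) t +
              dist t (behL (k : Ultralimit p U ≃ᵢ Ultralimit p U)) := dist_triangle _ _ _
        _ < ε₀ + ε₀ := add_lt_add (h4 t (hTfin.mem_toFinset.2 ht)) (by rwa [dist_comm])
        _ = 2 * ε₀ := by ring
    · exact ⟨1, fun h ↦ (hk h).elim⟩
  choose ψ hψ using hψex
  have h10 : ε = 10 * ε₀ := by simp only [hε₀]; ring
  refine ⟨f, φ, ψ, ⟨?_, ?_, ?_⟩, ?_, ?_, ?_⟩
  · -- base points
    show c (kf (p i)) = _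
    rw [hkf0, hc0]
  · -- distortion on `B̄(pᵢ, r)`
    intro x₁ h₁ x₂ h₂
    obtain ⟨hk₁, hd₁⟩ := hkfP x₁ (closedBall_subset_closedBall hrR h₁)
    obtain ⟨hk₂, hd₂⟩ := hkfP x₂ (closedBall_subset_closedBall hrR h₂)
    have hA := hi' _ hk₁ _ hk₂
    have hB : |dist (e i (kf x₁)) (e i (kf x₂)) - dist x₁ x₂| ≤ 4 * ε₀ := by
      have e1 := abs_dist_sub_le (e i (kf x₁)) x₁ (e i (kf x₂))
      have e2 := abs_dist_sub_le (e i (kf x₂)) x₂ x₁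
      rw [dist_comm (e i (kf x₂)) x₁, dist_comm x₂ x₁] at e2
      rw [dist_comm x₁ (e i (kf x₁))] at hd₁
      rw [dist_comm x₂ (e i (kf x₂))] at hd₂
      have := abs_sub_le (dist (e i (kf x₁)) (e i (kf x₂))) (dist x₁ (e i (kf x₂))) (dist x₁ x₂)
      linarith
    show |dist (c (kf x₁)) (c (kf x₂)) - dist x₁ x₂| ≤ ε
    have := abs_sub_le (dist (c (kf x₁)) (c (kf x₂))) (dist (e i (kf x₁)) (e i (kf x₂))) (dist x₁ x₂)
    rw [abs_sub_comm] at hA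
    linarith
  · -- density in `B̄(basePt, r - 2ε)`
    intro y hy
    obtain ⟨yy, rfl⟩ := mk_surjective y
    have hy' : dist (mk yy) (basePt p U) ≤ r - 2 * ε := mem_closedBall.1 hy
    have hyb : dist yy (PreUltralimit.base p U) ≤ r - 2 * ε := by
      rwa [basePt, dist_mk] at hy'
    have hyR : ∀ᶠ j in (U : Filter ℕ), dist (yy.seq j) (p j) < R := by
      have hlt : dist yy (PreUltralimit.base p U) < R := by linarith
      simpa using PreUltralimit.eventually_dist_lt hlt
    have hycov : ∀ᶠ j in (U : Filter ℕ), ∃ k, k ≤ N ∧ dist (yy.seq j) (e j k) ≤ 2 * ε₀ :=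
      hyR.mono fun j hj ↦ hecov j _ (mem_closedBall.2 hj.le)
    obtain ⟨k, hkN, hk⟩ := U.exists_le_eventually_of_eventually_exists_le hycov
    have hyk : dist (mk yy) (c k) ≤ 2 * ε₀ := by
      rw [hc, dist_mk]
      exact PreUltralimit.dist_le_of_eventually_le hk
    -- the net point `eᵢ k` is within `r` of `pᵢ` up to the errors: we use it if it lies in
    -- `B̄(pᵢ, r)`; in general we move to a net point of `y`'s shadow inside `B̄(pᵢ, r)`:
    -- `d(eᵢ k, pᵢ) ≈ d(c k, q) ≤ d(y, q) + 2ε₀ ≤ r - 2ε + 2ε₀ < r`.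
    have hek : e i k ∈ closedBall (p i) r := by
      rw [mem_closedBall]
      have h1 := hi' k hkN 0 (Nat.zero_le _)
      rw [he0, hc0] at h1
      have h2 : dist (c k) (basePt p U) ≤ dist (c k) (mk yy) + dist (mk yy) (basePt p U) :=
        dist_triangle _ _ _
      rw [dist_comm (c k) (mk yy)] at h2
      have := (abs_lt.1 h1).2
      have hε10 : ε = 10 * ε₀ := h10
      linarith
    refine ⟨e i k, hek, ?_⟩
    obtain ⟨hk', hd'⟩ := hkfP (e i k) (closedBall_subset_closedBall hrR hek)
    have hA := hi' _ hk' _ hkN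
    show dist (c (kf (e i k))) (mk yy) ≤ ε
    calc dist (c (kf (e i k))) (mk yy)
        ≤ dist (c (kf (e i k))) (c k) + dist (c k) (mk yy) := dist_triangle _ _ _
      _ ≤ (dist (e i (kf (e i k))) (e i k) + ε₀) + 2 * ε₀ := by
          gcongr
          · have := (abs_lt.1 hA).1
            linarith
          · rwa [dist_comm]
      _ ≤ (2 * ε₀ + ε₀) + 2 * ε₀ := by
          gcongr
          rwa [dist_comm]
      _ ≤ ε := by rw [h10]; linarith
  · -- almost-equivariance along `φ`
    intro γ hγ x hx
    have h := key γ (φ γ : Ultralimit p U ≃ᵢ Ultralimit p U) ε₀ (hφ γ hγ) (by linarith) x hx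
    show dist ((φ γ : Ultralimit p U ≃ᵢ Ultralimit p U) (f x)) (f (γ • x)) ≤ ε
    linarith
  · -- almost-equivariance along `ψ`
    intro k hk x hx
    replace hk : dist ((k : Ultralimit p U ≃ᵢ Ultralimit p U) (basePt p U)) (basePt p U) ≤ r := hk
    obtain ⟨hdisp, hclose⟩ := hψ k hk
    have h := key (ψ k) (k : Ultralimit p U ≃ᵢ Ultralimit p U) (2 * ε₀) hclose hdisp x hx
    show dist ((k : Ultralimit p U ≃ᵢ Ultralimit p U) (f x)) (f (ψ k • x)) ≤ ε
    linarith
  · -- `ψ` almost preserves displacements: entry `(0, 0)` of the behaviours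
    intro k hk
    replace hk : dist ((k : Ultralimit p U ≃ᵢ Ultralimit p U) (basePt p U)) (basePt p U) ≤ r := hk
    show dist (ψ k • p i) (p i) ≤
      dist ((k : Ultralimit p U ≃ᵢ Ultralimit p U) (basePt p U)) (basePt p U) + ε
    obtain ⟨-, hclose⟩ := hψ k hk
    have hentry := dist_le_pi_dist (beh i (ψ k)) (behL (k : Ultralimit p U ≃ᵢ Ultralimit p U))
      ((0 : Fin (N + 1)), (0 : Fin (N + 1)))
    have hB : beh i (ψ k) ((0 : Fin (N + 1)), (0 : Fin (N + 1))) = dist (ψ k • p i) (p i) := by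
      show dist (ψ k • e i 0) (e i 0) = _
      rw [he0]
    have hL : behL (k : Ultralimit p U ≃ᵢ Ultralimit p U) ((0 : Fin (N + 1)), (0 : Fin (N + 1))) =
        dist ((k : Ultralimit p U ≃ᵢ Ultralimit p U) (basePt p U)) (basePt p U) := by
      show dist ((k : Ultralimit p U ≃ᵢ Ultralimit p U) (c 0)) (c 0) = _
      rw [hc0]
    rw [hB, hL, Real.dist_eq] at hentry
    have := (abs_lt.1 (hentry.trans_lt hclose)).2
    linarith

/-! ### §3. The theorem: an equivariantly convergent subsequence -/

/-- **Fukaya–Yamaguchi's theorem, pointed form** (Huang–Huang–Wang–Zhu 2026, Thm 2.1): if the balls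
of the pointed spaces `(Xᵢ, pᵢ)` with isometric actions of groups `Γᵢ` have uniformly bounded
covering numbers at every scale, then for every ultrafilter `U` finer than `atTop` a subsequence
`(X_{φ n}, p_{φ n}, Γ_{φ n})` converges in the pointed EQUIVARIANT Gromov–Hausdorff sense
(`PointedEquivGHConv`) to the ultralimit `(lim_U Xᵢ, basePt)` with the limit group
`limitGroup Γ p U ≤ Isom(lim_U Xᵢ)` (a proper space, `properSpace_ultralimit`).
[cite: HuangHuangWangZhu2026, §2.1 p. 6 Thm 2.1] -/
theorem exists_strictMono_pointedEquivGHConv (hU : (U : Filter ℕ) ≤ atTop)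
    (hcov : ∀ (R ε : ℝ), 0 < ε → ∃ N : ℕ, ∀ i, ∃ S : Finset (X i), S.card ≤ N ∧
      ∀ x ∈ closedBall (p i) R, ∃ s ∈ S, dist x s ≤ ε) :
    ∃ φ : ℕ → ℕ, StrictMono φ ∧
      PointedEquivGHConv (X := fun n ↦ X (φ n)) (fun n ↦ Γ (φ n)) (limitGroup Γ p U)
        (fun n ↦ p (φ n)) (basePt p U) := by
  set P : ℕ → ℕ → Prop := fun n i ↦ ∃ (f : X i → Ultralimit p U) (φ : Γ i → limitGroup Γ p U)
    (ψ : limitGroup Γ p U → Γ i),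
      IsPointedEquivGHApprox (n : ℝ) (1 / ((n : ℝ) + 1)) (p i) (basePt p U) f φ ψ with hP
  have hPn : ∀ n, ∀ᶠ i in (U : Filter ℕ), P n i := fun n ↦
    eventually_exists_isPointedEquivGHApprox hcov (Nat.cast_nonneg n) (by positivity)
  have hQ : ∀ n, ∃ᶠ i in atTop, ∀ j ∈ Finset.range (n + 1), P j i := fun n ↦
    frequently_atTop_of_eventually_ultrafilter hU
      ((Filter.eventually_all_finset _).2 fun j _ ↦ hPn j)
  obtain ⟨φ, hφ, hφP⟩ := extraction_forall_of_frequently hQ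
  refine ⟨φ, hφ, fun R ε hε ↦ ?_⟩
  obtain ⟨n₀, hn₀⟩ : ∃ n₀ : ℕ, R ≤ n₀ ∧ 1 / ((n₀ : ℝ) + 1) ≤ ε := by
    obtain ⟨m, hm⟩ := exists_nat_ge (max R (1 / ε))
    refine ⟨m, (le_max_left _ _).trans hm, ?_⟩
    have h1 : 1 / ε ≤ (m : ℝ) + 1 := ((le_max_right _ _).trans hm).trans (by linarith)
    rw [div_le_iff₀ (by positivity)]
    calc (1 : ℝ) = 1 / ε * ε := by field_simp
      _ ≤ ((m : ℝ) + 1) * ε := by gcongr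
      _ = ε * ((m : ℝ) + 1) := by ring
  refine (eventually_ge_atTop n₀).mono fun m hm ↦ ?_
  obtain ⟨f, φ', ψ', hf⟩ := hφP m n₀ (Finset.mem_range.2 (Nat.lt_succ_iff.2 hm))
  exact ⟨f, φ', ψ', hf.mono hn₀.1 hn₀.2⟩

/-- The same with the hyperfilter: **uniformly totally bounded pointed spaces with isometric group
actions have an equivariantly convergent subsequence** with proper limit and limit group.
[cite: HuangHuangWangZhu2026, §2.1 p. 6 Thm 2.1] -/
theorem exists_strictMono_pointedEquivGHConv_hyperfilter
    (hcov : ∀ (R ε : ℝ), 0 < ε → ∃ N : ℕ, ∀ i, ∃ S : Finset (X i), S.card ≤ N ∧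
      ∀ x ∈ closedBall (p i) R, ∃ s ∈ S, dist x s ≤ ε) :
    ProperSpace (Ultralimit p (hyperfilter ℕ)) ∧
      ∃ φ : ℕ → ℕ, StrictMono φ ∧
        PointedEquivGHConv (X := fun n ↦ X (φ n)) (fun n ↦ Γ (φ n))
          (limitGroup Γ p (hyperfilter ℕ)) (fun n ↦ p (φ n)) (basePt p (hyperfilter ℕ)) := by
  have hU : ((hyperfilter ℕ : Ultrafilter ℕ) : Filter ℕ) ≤ atTop := by
    rw [← Nat.cofinite_eq_atTop]
    exact hyperfilter_le_cofinite
  exact ⟨properSpace_ultralimit hU hcov, exists_strictMono_pointedEquivGHConv hU hcov⟩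

end Ultralimit

end Literature.Geometry.MetricGeometry
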